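import Literature.NumberTheory.EllipticCurves.SexticTwistLSeriesCoefficients
import Literature.NumberTheory.EllipticCurves.ModularityVersionApProofs
import HarnessLib

/-!
# The bad primes of the sextic twists `E^k : y² = x³ + k` (`k ∈ ℤ` sixth-power-free): `p ∣ N(E^k)` decided, and `a_p(E^k) = 0` there

Topic `NumberTheory/EllipticCurves` (namespace `Literature.NumberTheory.EllipticCurves.SexticTwist`).  THEOREMS ONLY (no definition,
no named fact, no `sorry`).  The `j = 0` twin of `QuarticTwist.dvd_conductorNorm_iff` (`QuarticTwistDeuringCore` §2): the CURVE SIDE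
of Deuring's theorem for the family `y² = x³ + k` — which rational primes divide the conductor of `mordellCurve k = ⟨0, 0, 0, 0, k⟩ / ℚ`
for `k ≠ 0` free of sixth powers — assembled from the reduction types already in the tree (`SexticTwistLSeriesCoefficients` §2–§3:
Silverman VII.5.1 (c) for `0 < ord_p Δ < 12`, Tate's algorithm for the cells `3⁵ ∥ k`, `2⁵ ∥ k`, `k = 16u` with `u ≡ 3 (4)` (type `II*`),
and the one good cell at `2`, `k = 16u` with `u ≡ 1 (4)`, `hasGoodReductionAt_mordell_four_of_emod_four_eq_one`) and the
dictionary `p ∣ N_W ↔ ¬ good at p` (`WeierstrassCurve.dvd_conductorNorm_iff`, Diamond–Shurman §8.3).  Ireland–Rosen Ch. 18 §7: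
«if `P ∣ 6D` define `χ(P) = 0`» — on Mathlib's `W.LFunction` the finitely many Euler factors at `2`, `3` and the primes of `k`
must be decided exactly, and the answer is:

  **`p ∣ N(E^k) ↔ p = 3 ∨ (5 ≤ p ∧ p ∣ k) ∨ (p = 2 ∧ ¬ ∃ u, u ≡ 1 (mod 4) ∧ k = 16u)`**

(`3` is ALWAYS bad — `ord₃ Δ = 3 + 2 ord₃ k` is odd; `2` is bad unless `k ∈ 16·(1 + 4ℤ)`; `p ≥ 5` is bad iff `p ∣ k`).

* `hasAdditiveReductionAt_of_isBad`, `hasGoodReductionAt_of_not_isBad` — the dichotomy at every finite place;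
* ★ `dvd_conductorNorm_iff` — the displayed equivalence; corollaries `three_dvd_conductorNorm`, `dvd_conductorNorm_of_five_le`,
  `two_dvd_conductorNorm_iff`, `not_dvd_of_not_dvd_conductorNorm` (`p ∤ N ⇒ p ≠ 3 ∧ (p ∣ k → p = 2 ∧ k ∈ 16(1+4ℤ))`);
* ★ `lFunction_apply_prime_eq_zero_of_dvd_conductorNorm` — `a_p(E^k) = 0` at every bad prime (the hypothesis `hbad` of the Summits
  consumer `…DeuringCoreOfDatumSet.core_of_datum_set`, route `BiquadraticEisensteinDescent` of `Summits/BirchSwinnertonDyer`, crux 21341).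
* §4 (appended) the good-at-`2` class `k = 16u`, `u ≡ 1 (4)`: `dvd_conductorNorm_iff_of_eq_sixteen_mul` (`p ∣ N ↔ p = 3 ∨ (5 ≤ p ∧ p ∣ u)`),
  `two_not_dvd_conductorNorm_of_eq_sixteen_mul`, `not_dvd_three_mul_of_not_dvd_conductorNorm`, `dvd_of_dvd_conductorNorm_of_ne_three`.

Honest scope: UNCONDITIONAL (standard axioms); nothing about BSD is proved here; the Hecke-character side of the row `j = 0` of
`Deuring_exists_heckeCharacter_of_maximalCM` (the Größencharakter `(k/N𝔭)(4k/𝔭)₃ϖ_𝔭` of `ℚ(ζ₃)`, its ramification at the primes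
above these bad `p`) is the business of `GaloisRepresentations/EisensteinSextic*`.

## References
* K. Ireland, M. Rosen, *A Classical Introduction to Modern Number Theory*, 2nd ed., GTM 84 (1990), Ch. 18 §3, §7. [IrelandRosen1990]
* J. H. Silverman, *The Arithmetic of Elliptic Curves*, 2nd ed. (2009), VII.1 Remark 1.1, VII.5 Prop. 5.1, §C.16. [SilvermanAEC2009]
* J. H. Silverman, *Advanced Topics in the Arithmetic of Elliptic Curves* (1994), IV.9.4, Table 4.1, IV.10.2. [SilvermanATAEC1994]
* F. Diamond, J. Shurman, *A First Course in Modular Forms*, GTM 228 (2005), §8.3. [DiamondShurman2005]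

## Mathlib / tree search
Tree: `SexticTwist.{hasAdditiveReductionAt_of_five_le, hasAdditiveReductionAt_three_of_not_dvd, hasAdditiveReductionAt_three_of_dvd,
hasAdditiveReductionAt_two_of_not_dvd, hasAdditiveReductionAt_two_of_dvd, hasAdditiveReductionAt_two_of_eq_sixteen_mul,
hasGoodReductionAt_of_not_dvd, lFunction_apply_prime_pow_eq_zero}` (`SexticTwistLSeriesCoefficients`);
`hasGoodReductionAt_mordell_four_of_emod_four_eq_one` (`MordellCurveTateAlgorithmTwoProofs`); `WeierstrassCurve.dvd_conductorNorm_iff`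
(`ModularityVersionApProofs`); `isElliptic_mordellCurve`, `mordellCurve` (`MordellCurveThreeDescent`); `prime_natGenerator`,
`HasGoodReductionAt.not_hasAdditiveReductionAt`.  `lean search 'mordellCurve.*conductorNorm'`: only consumers (`MordellShaFreeCut*`), no
decision of the bad primes existed.
-/

noncomputable section

open scoped Classical

open WeierstrassCurve IsDedekindDomain NumberField Rat.HeightOneSpectrum
open Literature.NumberTheory.GaloisRepresentations

namespace Literature.NumberTheory.EllipticCurves

namespace SexticTwist

variable {k : ℤ}

/-! ### §1 The dichotomy at every finite place -/

section Places

variable (v : HeightOneSpectrum (𝓞 ℚ))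

/-- **`E^k` is ADDITIVE at every bad cell** (`k ≠ 0` sixth-power-free): at `3`; at every `p ≥ 5` dividing `k`; at `2` unless
`k = 16u` with `u ≡ 1 (mod 4)` — Silverman VII.5.1 (c) when `0 < ord_p Δ < 12` (`Δ = −2⁴3³k²`, `c₄ = 0`), Tate's algorithm (type
`II*`) in the cells `3⁵ ∥ k`, `2⁵ ∥ k`, `k = 16u` with `u ≡ 3 (4)`.  (The case analysis of `lFunction_apply_prime_pow_eq_zero`, kept at
the level of the reduction type.) [cite: SilvermanAEC2009, VII.5 Prop. 5.1(c) and VII.1 Remark 1.1] [cite: SilvermanATAEC1994, IV.9.4 and Table 4.1] -/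
theorem hasAdditiveReductionAt_of_isBad (hk : k ≠ 0) (h6 : ∀ q : ℕ, q.Prime → ¬ (q : ℤ) ^ 6 ∣ k)
    (hcase : natGenerator v = 3 ∨ (5 ≤ natGenerator v ∧ (natGenerator v : ℤ) ∣ k) ∨
      (natGenerator v = 2 ∧ ¬ ∃ u : ℤ, u % 4 = 1 ∧ k = 16 * u)) :
    (mordellCurve (k : ℚ)).HasAdditiveReductionAt v := by
  have hp := prime_natGenerator v
  rcases hcase with hv | ⟨h5, hpk⟩ | ⟨hv, hno⟩
  · by_cases h35 : (3 : ℤ) ^ 5 ∣ k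
    · exact hasAdditiveReductionAt_three_of_dvd v hk hv h35 (by exact_mod_cast h6 3 Nat.prime_three)
    · exact hasAdditiveReductionAt_three_of_not_dvd v hk hv h35
  · exact hasAdditiveReductionAt_of_five_le v hk h5 hpk (by exact_mod_cast h6 _ hp)
  · by_cases h24 : (2 : ℤ) ^ 4 ∣ k
    · by_cases h25 : (2 : ℤ) ^ 5 ∣ k
      · exact hasAdditiveReductionAt_two_of_dvd v hk hv h25 (by exact_mod_cast h6 2 Nat.prime_two)
      · obtain ⟨u, rfl⟩ := h24
        have hu2 : ¬ (2 : ℤ) ∣ u := fun h ↦ h25 (by rw [pow_succ]; exact mul_dvd_mul_left _ h)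
        have hu4 : u % 4 = 3 := by
          rcases Int.emod_two_eq_zero_or_one u with h | h
          · exact absurd (Int.dvd_of_emod_eq_zero h) hu2
          · have : u % 4 = 1 ∨ u % 4 = 3 := by omega
            rcases this with h1 | h3
            · exact absurd ⟨u, h1, by norm_num⟩ hno
            · exact h3
        exact hasAdditiveReductionAt_two_of_eq_sixteen_mul v hv hu4 (by norm_num)
    · exact hasAdditiveReductionAt_two_of_not_dvd v hk hv h24

/-- **`E^k` has GOOD reduction at every other place**: if the prime `p` under `v` is not `3`, does not divide `k` unless `p < 5`, and
is not `2` unless `k = 16u` with `u ≡ 1 (mod 4)`, then `E^k` has good reduction at `v` — `p ∤ 6k` (`hasGoodReductionAt_of_not_dvd`,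
`p ∤ Δ`) or the good cell at `2` (`y² + y = x³ + (u − 1)/4`, `hasGoodReductionAt_mordell_four_of_emod_four_eq_one`).
[cite: SilvermanAEC2009, VII.5 Prop. 5.1(a) and VII.1 Remark 1.1] [cite: IrelandRosen1990, Ch. 18 §3 (PDF p. 298)] -/
theorem hasGoodReductionAt_of_not_isBad
    (hcase : ¬ (natGenerator v = 3 ∨ (5 ≤ natGenerator v ∧ (natGenerator v : ℤ) ∣ k) ∨
      (natGenerator v = 2 ∧ ¬ ∃ u : ℤ, u % 4 = 1 ∧ k = 16 * u))) :
    (mordellCurve (k : ℚ)).HasGoodReductionAt v := by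
  have hp := prime_natGenerator v
  push Not at hcase
  obtain ⟨h3, h5, h2⟩ := hcase
  by_cases hv2 : natGenerator v = 2
  · obtain ⟨u, hu, hku⟩ := h2 hv2
    exact hasGoodReductionAt_mordell_four_of_emod_four_eq_one v hv2 (mordellCurve (k : ℚ)) rfl rfl rfl rfl hu
      (by rw [hku]; rfl)
  · have h5' : 5 ≤ natGenerator v := by
      have h2le := hp.two_le
      by_contra hlt
      interval_cases h : natGenerator v
      · exact hv2 rfl
      · exact h3 rfl
      · exact absurd hp (by decide)
    exact hasGoodReductionAt_of_not_dvd v hv2 h3 (h5 h5')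

end Places

/-! ### §2 The bad primes of `E^k`: `p ∣ N(E^k)` decided -/

section Conductor

/-- The finite place of `ℚ` under a rational prime, with `primesEquiv v = p` (hence `natGenerator v = p`). [folklore] -/
private theorem exists_primesEquiv_eq {p : ℕ} (hp : p.Prime) : ∃ v : HeightOneSpectrum (𝓞 ℚ), (primesEquiv v : ℕ) = p :=
  ⟨primesEquiv.symm ⟨p, hp⟩, by rw [Equiv.apply_symm_apply]⟩

/-- ★ **The bad primes of `E^k : y² = x³ + k`** (`k ≠ 0` free of sixth powers): for a prime `p`,
`p ∣ N(E^k) ↔ p = 3 ∨ (5 ≤ p ∧ p ∣ k) ∨ (p = 2 ∧ ¬ ∃ u, u ≡ 1 (mod 4) ∧ k = 16u)` — additive reduction in the three listed cells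
(`hasAdditiveReductionAt_of_isBad`), good reduction otherwise (`hasGoodReductionAt_of_not_isBad`), and `p ∣ N_W ↔ ¬` good at `p`
(`WeierstrassCurve.dvd_conductorNorm_iff`).  In particular `3 ∣ N(E^k)` always, in accordance with Deuring's `N_E = |d_K|·N(𝔣_ψ)`,
`d_K = −3`. Ireland–Rosen: «if `P ∣ 6D` define `χ(P) = 0`». [cite: IrelandRosen1990, Ch. 18 §7] [cite: SilvermanAEC2009, VII.5 Prop. 5.1] [cite: DiamondShurman2005, §8.3 (PDF p. 353)] -/
theorem dvd_conductorNorm_iff (hk : k ≠ 0) (h6 : ∀ q : ℕ, q.Prime → ¬ (q : ℤ) ^ 6 ∣ k) {p : ℕ} (hp : p.Prime) :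
    p ∣ (mordellCurve (k : ℚ)).conductorNorm ℤ ↔
      p = 3 ∨ (5 ≤ p ∧ (p : ℤ) ∣ k) ∨ (p = 2 ∧ ¬ ∃ u : ℤ, u % 4 = 1 ∧ k = 16 * u) := by
  haveI := isElliptic_mordellCurve (Int.cast_ne_zero.mpr hk : (k : ℚ) ≠ 0)
  obtain ⟨v, hv⟩ := exists_primesEquiv_eq hp
  subst hv
  rw [(mordellCurve (k : ℚ)).dvd_conductorNorm_iff v, show (primesEquiv v : ℕ) = natGenerator v from rfl]
  constructor
  · intro hbad
    by_contra hcase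
    exact hbad (hasGoodReductionAt_of_not_isBad v hcase)
  · intro hcase hgood
    exact hgood.not_hasAdditiveReductionAt (hasAdditiveReductionAt_of_isBad v hk h6 hcase)

/-- **`3` is always a bad prime of `E^k`** (`k ≠ 0` sixth-power-free; `3` ramifies in the CM field `ℚ(√−3)`).
[cite: IrelandRosen1990, Ch. 18 §7] [cite: SilvermanAEC2009, VII.5 Prop. 5.1(c)] -/
theorem three_dvd_conductorNorm (hk : k ≠ 0) (h6 : ∀ q : ℕ, q.Prime → ¬ (q : ℤ) ^ 6 ∣ k) :
    3 ∣ (mordellCurve (k : ℚ)).conductorNorm ℤ :=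
  (dvd_conductorNorm_iff hk h6 Nat.prime_three).mpr (Or.inl rfl)

/-- **Every prime `p ≥ 5` dividing `k` is a bad prime of `E^k`** (`k` sixth-power-free). [cite: IrelandRosen1990, Ch. 18 §7] [cite: SilvermanAEC2009, VII.5 Prop. 5.1(c)] -/
theorem dvd_conductorNorm_of_five_le (hk : k ≠ 0) (h6 : ∀ q : ℕ, q.Prime → ¬ (q : ℤ) ^ 6 ∣ k) {p : ℕ} (hp : p.Prime)
    (h5 : 5 ≤ p) (hpk : (p : ℤ) ∣ k) : p ∣ (mordellCurve (k : ℚ)).conductorNorm ℤ :=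
  (dvd_conductorNorm_iff hk h6 hp).mpr (Or.inr (Or.inl ⟨h5, hpk⟩))

/-- **`2` is a bad prime of `E^k` unless `k = 16u` with `u ≡ 1 (mod 4)`** (`k ≠ 0` sixth-power-free; the good cell is
`y² + y = x³ + (u − 1)/4`). [cite: SilvermanAEC2009, VII.5 Prop. 5.1] [cite: SilvermanATAEC1994, IV.9.4 and Table 4.1] -/
theorem two_dvd_conductorNorm_iff (hk : k ≠ 0) (h6 : ∀ q : ℕ, q.Prime → ¬ (q : ℤ) ^ 6 ∣ k) :
    2 ∣ (mordellCurve (k : ℚ)).conductorNorm ℤ ↔ ¬ ∃ u : ℤ, u % 4 = 1 ∧ k = 16 * u := by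
  rw [dvd_conductorNorm_iff hk h6 Nat.prime_two]
  constructor
  · rintro (h | ⟨h, -⟩ | ⟨-, h⟩)
    · exact absurd h (by norm_num)
    · exact absurd h (by norm_num)
    · exact h
  · exact fun h ↦ Or.inr (Or.inr ⟨rfl, h⟩)

/-- **A good prime of `E^k` is `≠ 3`, and divides `6k` only in the good cell at `2`**: if `p ∤ N(E^k)` then `p ≠ 3` and
(`p ∣ 6k → p = 2 ∧ ∃ u, u ≡ 1 (mod 4) ∧ k = 16u`). (`k ≠ 0` sixth-power-free.) [cite: IrelandRosen1990, Ch. 18 §7] [cite: SilvermanAEC2009, VII.5 Prop. 5.1] -/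
theorem not_dvd_of_not_dvd_conductorNorm (hk : k ≠ 0) (h6 : ∀ q : ℕ, q.Prime → ¬ (q : ℤ) ^ 6 ∣ k) {p : ℕ} (hp : p.Prime)
    (hpN : ¬ p ∣ (mordellCurve (k : ℚ)).conductorNorm ℤ) :
    p ≠ 3 ∧ ((p : ℤ) ∣ 6 * k → p = 2 ∧ ∃ u : ℤ, u % 4 = 1 ∧ k = 16 * u) := by
  rw [dvd_conductorNorm_iff hk h6 hp] at hpN
  push Not at hpN
  obtain ⟨h3, h5, h2⟩ := hpN
  refine ⟨h3, fun h6k ↦ ?_⟩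
  by_cases hp2 : p = 2
  · exact ⟨hp2, h2 hp2⟩
  · exfalso
    have h5' : 5 ≤ p := by
      have h2le := hp.two_le
      by_contra hlt
      interval_cases h : p
      · exact hp2 rfl
      · exact h3 rfl
      · exact absurd hp (by decide)
    have hp6 : ¬ (p : ℤ) ∣ 6 := by
      intro h
      have h' : p ∣ 2 * 3 := by exact_mod_cast h
      rcases (Nat.Prime.dvd_mul hp).mp h' with h | h
      · have := (Nat.prime_dvd_prime_iff_eq hp Nat.prime_two).mp h; omega
      · have := (Nat.prime_dvd_prime_iff_eq hp Nat.prime_three).mp h; omega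
    have hpk : (p : ℤ) ∣ k :=
      (Int.Prime.dvd_mul' hp h6k).resolve_left hp6
    exact h5 h5' hpk

end Conductor

/-! ### §3 `a_p(E^k) = 0` at every bad prime -/

section BadEuler

/-- ★ **`a_p(E^k) = 0` at every bad prime `p` of `E^k`** (`k ≠ 0` sixth-power-free): the reduction is additive there, Euler factor
`1` — Ireland–Rosen «if `P ∣ 6D` then `χ(P) = 0`», read on Mathlib's `W.LFunction` (`lFunction_apply_prime_pow_eq_zero` through
`dvd_conductorNorm_iff`).  This is the first conjunct of the hypothesis `hbad` of `core_of_datum_set`.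
[cite: IrelandRosen1990, Ch. 18 §7] [cite: SilvermanAEC2009, §C.16 (definition of L_v(T))] -/
theorem lFunction_apply_prime_eq_zero_of_dvd_conductorNorm (hk : k ≠ 0) (h6 : ∀ q : ℕ, q.Prime → ¬ (q : ℤ) ^ 6 ∣ k)
    {p : ℕ} (hp : p.Prime) (hpN : p ∣ (mordellCurve (k : ℚ)).conductorNorm ℤ) :
    (mordellCurve (k : ℚ)).LFunction p = 0 := by
  simpa using lFunction_apply_prime_pow_eq_zero hk h6 hp ((dvd_conductorNorm_iff hk h6 hp).mp hpN) 0

/-- **`a_{p^{j+1}}(E^k) = 0` at every bad prime `p` of `E^k`** (Euler factor `1`). [cite: IrelandRosen1990, Ch. 18 §7] [cite: SilvermanAEC2009, §C.16 (definition of L_v(T))] -/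
theorem lFunction_apply_prime_pow_eq_zero_of_dvd_conductorNorm (hk : k ≠ 0) (h6 : ∀ q : ℕ, q.Prime → ¬ (q : ℤ) ^ 6 ∣ k)
    {p : ℕ} (hp : p.Prime) (hpN : p ∣ (mordellCurve (k : ℚ)).conductorNorm ℤ) (j : ℕ) :
    (mordellCurve (k : ℚ)).LFunction (p ^ (j + 1)) = 0 :=
  lFunction_apply_prime_pow_eq_zero hk h6 hp ((dvd_conductorNorm_iff hk h6 hp).mp hpN) j

end BadEuler


/-! ### §4 The good-at-`2` class `k = 16u`, `u ≡ 1 (mod 4)`: bad primes `= {3} ∪ {p ≥ 5 : p ∣ u}` -/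

section GoodTwo

/-- ★ **The bad primes of `y² = x³ + 16u`, `u ≡ 1 (mod 4)`** (`16u` sixth-power-free): `p ∣ N(E^{16u}) ↔ p = 3 ∨ (5 ≤ p ∧ p ∣ u)` —
the curve has good reduction at `2` (`y² + y = x³ + (u − 1)/4`), so `2` drops out, and an odd prime divides `16u` iff it divides `u`.
This is the case split of Deuring's theorem for the good-at-`2` sextic twists (ramification of the `(9u)`-character `psiOdd u` exactly
above these primes). [cite: IrelandRosen1990, Ch. 18 §4 Theorem 5 and §7] [cite: SilvermanAEC2009, VII.5 Prop. 5.1] -/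
theorem dvd_conductorNorm_iff_of_eq_sixteen_mul {u : ℤ} (hu4 : u % 4 = 1) (h6 : ∀ q : ℕ, q.Prime → ¬ (q : ℤ) ^ 6 ∣ 16 * u)
    {p : ℕ} (hp : p.Prime) :
    p ∣ (mordellCurve ((16 * u : ℤ) : ℚ)).conductorNorm ℤ ↔ p = 3 ∨ (5 ≤ p ∧ (p : ℤ) ∣ u) := by
  have hu : u ≠ 0 := by rintro rfl; omega
  have hk : (16 * u : ℤ) ≠ 0 := mul_ne_zero (by norm_num) hu
  rw [dvd_conductorNorm_iff hk h6 hp]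
  constructor
  · rintro (h3 | ⟨h5, hpk⟩ | ⟨-, hno⟩)
    · exact Or.inl h3
    · refine Or.inr ⟨h5, ?_⟩
      have hp2 : ¬ (p : ℤ) ∣ 16 := by
        intro h
        have h' : p ∣ 2 ^ 4 := by exact_mod_cast h
        have := (Nat.prime_dvd_prime_iff_eq hp Nat.prime_two).mp (hp.dvd_of_dvd_pow h')
        omega
      exact (Int.Prime.dvd_mul' hp hpk).resolve_left hp2
    · exact absurd ⟨u, hu4, rfl⟩ hno
  · rintro (h3 | ⟨h5, hpu⟩)
    · exact Or.inl h3
    · exact Or.inr (Or.inl ⟨h5, hpu.mul_left 16⟩)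

/-- **`2 ∤ N(E^{16u})` for `u ≡ 1 (mod 4)`**: good reduction at `2`. [cite: SilvermanAEC2009, VII.5 Prop. 5.1(a)] [cite: IrelandRosen1990, Ch. 18 §4 Theorem 5] -/
theorem two_not_dvd_conductorNorm_of_eq_sixteen_mul {u : ℤ} (hu4 : u % 4 = 1) (h6 : ∀ q : ℕ, q.Prime → ¬ (q : ℤ) ^ 6 ∣ 16 * u) :
    ¬ 2 ∣ (mordellCurve ((16 * u : ℤ) : ℚ)).conductorNorm ℤ := by
  rw [dvd_conductorNorm_iff_of_eq_sixteen_mul hu4 h6 Nat.prime_two]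
  rintro (h | ⟨h, -⟩) <;> omega

/-- **A good prime of `E^{16u}` does not divide `3u`** (`u ≡ 1 (mod 4)`): the shape of the hypothesis of the Frobenius block of the
`(9u)`-character (`SexticTwist.psiOdd_frobenius`). [cite: IrelandRosen1990, Ch. 18 §7] [cite: SilvermanAEC2009, VII.5 Prop. 5.1] -/
theorem not_dvd_three_mul_of_not_dvd_conductorNorm {u : ℤ} (hu4 : u % 4 = 1) (h6 : ∀ q : ℕ, q.Prime → ¬ (q : ℤ) ^ 6 ∣ 16 * u)
    {p : ℕ} (hp : p.Prime) (hpN : ¬ p ∣ (mordellCurve ((16 * u : ℤ) : ℚ)).conductorNorm ℤ) : ¬ (p : ℤ) ∣ 3 * u := by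
  rw [dvd_conductorNorm_iff_of_eq_sixteen_mul hu4 h6 hp] at hpN
  push Not at hpN
  obtain ⟨h3, h5⟩ := hpN
  intro h3u
  rcases Int.Prime.dvd_mul' hp h3u with h | h
  · have h' : p ∣ 3 := by exact_mod_cast h
    exact h3 ((Nat.prime_dvd_prime_iff_eq hp Nat.prime_three).mp h')
  · by_cases hp2 : p = 2
    · subst hp2
      have : (2 : ℤ) ∣ u := by exact_mod_cast h
      omega
    · have h5' : 5 ≤ p := by
        have h2le := hp.two_le
        by_contra hlt
        interval_cases hq : p
        · exact hp2 rfl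
        · exact h3 rfl
        · exact absurd hp (by decide)
      exact h5 h5' h

/-- **A bad prime of `E^{16u}` other than `3` is a prime `p ≥ 5` of `u`** (`u ≡ 1 (mod 4)`): the shape of the hypothesis of the
ramification transfer `EisensteinSextic.not_isUnramifiedAt_heckeOfGross_psiOdd_of_dvd`. [cite: IrelandRosen1990, Ch. 18 §7] [cite: SilvermanAEC2009, VII.5 Prop. 5.1] -/
theorem dvd_of_dvd_conductorNorm_of_ne_three {u : ℤ} (hu4 : u % 4 = 1) (h6 : ∀ q : ℕ, q.Prime → ¬ (q : ℤ) ^ 6 ∣ 16 * u)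
    {p : ℕ} (hp : p.Prime) (hp3 : p ≠ 3) (hpN : p ∣ (mordellCurve ((16 * u : ℤ) : ℚ)).conductorNorm ℤ) :
    5 ≤ p ∧ (p : ℤ) ∣ u := by
  rw [dvd_conductorNorm_iff_of_eq_sixteen_mul hu4 h6 hp] at hpN
  exact hpN.resolve_left hp3

end GoodTwo

end SexticTwist

end Literature.NumberTheory.EllipticCurves

end
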